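import Summits.AtomisticToContinuum.Crystallization.Theorems.PricedLinkCensusTruncatedCensusGapChargeLocality

/-!
# Ring locality: the ring numbers of the bonds at a site only see the sites within `2(1+η)·nn` of it

Helper (R-LOCALITY) for the stub `stub_ringCensusGap` (class (R) of the census split
`Cruxes/TruncatedCensusGap/Lines/birth.lean`: twelve-coordinated sites having a bond with ring
number `≠ 4`) of the crux `PricedLinkCensus.TruncatedCensusGap` (item stmt-AtomisticToContinuum-14230).
Companion of the landed CHARGE LOCALITY `isChargeFree_sub_iff` / `isChargeFree_comp_embedding_iff`
(`…TruncatedCensusGapChargeLocality.lean`, whose `nearestDist_comp_eq_of_attained` is reused) and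
of the (U)-class NEIGHBOUR-SET LOCALITY `neighborSet_apply_eq_image_comp` / `ncard_neighborSet_sub_eq`
(`…TruncatedCensusGapUnderCoordinationLocality.lean`, a sibling not imported here): what is added is
the transport of the scales and of the bonds BETWEEN two bond-neighbours of the centre, hence of
common-neighbour sets and ring numbers.

In the SCALE-FREE bond graph `bondGraph η y` (`j ∼ k ↔ j ≠ k ∧ dist ≤ (1+η)·min (nn_j) (nn_k)`,
`Literature/Geometry/DiscreteGeometry/BondGraph.lean`) of a finite configuration `y : ι → X`, let
`f : κ ↪ ι` be a sub-family whose range contains every site within `2(1+η)·nn_{f i}` of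
`y (f i)` (`0 ≤ η`).  Comparing `y` at `f i` with the sub-configuration `y ∘ f` at `i`:

* `nearestDist_comp_embedding_eq_of_local`, `nearestDist_comp_embedding_eq_of_near`: the scale of
  `i`, and of every `a` with `y (f a)` within `(1+η)·nn_{f i}` of `y (f i)`, is unchanged (a
  nearest neighbour of `f a` lies within `(1+η)·nn + nn_{f a} ≤ 2(1+η)·nn` of `y (f i)`);
* `bondGraph_adj_comp_embedding_iff`, `mem_range_of_bondGraph_adj`,
  `bondGraph_adj_comp_embedding_iff_of_adj`: the bonds at `f i`, and the bonds between two
  bond-neighbours of `f i`, are the same in `y` and in `y ∘ f`, and every bond at `f i` ends in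
  the range of `f`;
* `neighborSet_inter_comp_embedding_eq`, `ringNumber_comp_embedding_eq`: the common-neighbour set
  of `f i` and a bond-neighbour `f a` is the `f`-image of that of `i` and `a` in `y ∘ f`, so the
  ring number of every bond at `f i` is that of the corresponding bond at `i`;
* `ringDefective_comp_embedding_iff` and the registered `Fin` form `ringDefective_sub_iff`: the
  (R)-predicate "twelve bonds and some bond with ring number `≠ 4`" is invariant under passing to
  such a sub-configuration — the locality input for reading the (R)-count in blocks and in
  periodisations (the `R`-twin of `Blocks.isChargeFree_block_iff` / `isChargeFree_toPoint_iff`).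

All `[folklore]`; Mathlib and `BondGraph.lean` only (through the charge-locality file).
-/

noncomputable section

namespace Summit.AtomisticToContinuum.Crystallization.Theorems.PricedLinkCensusTruncatedCensusGap

open Literature.MathematicalPhysics.StatisticalMechanics Literature.Geometry.DiscreteGeometry

section RingLocality

variable {ι κ X : Type*} [PseudoMetricSpace X] [Finite ι]

/-- **Scale at the centre.**  If the range of `f : κ ↪ ι` contains every site within
`2(1+η)·nn_{f i}` of `y (f i)` (`0 ≤ η`), then `nn_{y ∘ f}(i) = nn_y(f i)`: a nearest neighbour
of `f i` lies within `nn ≤ 2(1+η)·nn`, hence in the range (and with a single site both scales are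
the junk value `0`). [folklore] -/
theorem nearestDist_comp_embedding_eq_of_local {η : ℝ} (hη : 0 ≤ η) (y : ι → X) (f : κ ↪ ι)
    (i : κ)
    (hS : ∀ k, dist (y k) (y (f i)) ≤ 2 * (1 + η) * nearestDist y (f i) → k ∈ Set.range f) :
    nearestDist (y ∘ f) i = nearestDist y (f i) := by
  by_cases hN : ∃ k, k ≠ f i
  · obtain ⟨m, hm, hdm⟩ := exists_nearestDist_eq_dist y hN
    have hmS : m ∈ Set.range f := by
      refine hS m ?_
      rw [dist_comm, ← hdm]
      exact le_mul_of_one_le_left (nearestDist_nonneg y (f i)) (by linarith)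
    obtain ⟨b, rfl⟩ := hmS
    exact nearestDist_comp_eq_of_attained y f (f.injective.ne_iff.1 hm) hdm
  · push Not at hN
    haveI h1 : IsEmpty {k : ι // k ≠ f i} := ⟨fun k => k.2 (hN k.1)⟩
    haveI h2 : IsEmpty {a : κ // a ≠ i} := ⟨fun a => (f.injective.ne a.2) (hN (f a.1))⟩
    rw [nearestDist_def, nearestDist_def, Real.iInf_of_isEmpty, Real.iInf_of_isEmpty]

/-- **Scales near the centre.**  Under the same hypothesis, every `a : κ` with `y (f a)` within
`(1+η)·nn_{f i}` of `y (f i)` has `nn_{y ∘ f}(a) = nn_y(f a)`: a nearest neighbour of `f a` lies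
within `(1+η)·nn + nn_{f a} ≤ 2(1+η)·nn` of `y (f i)`, hence in the range. [folklore] -/
theorem nearestDist_comp_embedding_eq_of_near {η : ℝ} (hη : 0 ≤ η) (y : ι → X) (f : κ ↪ ι)
    (i : κ)
    (hS : ∀ k, dist (y k) (y (f i)) ≤ 2 * (1 + η) * nearestDist y (f i) → k ∈ Set.range f)
    {a : κ} (ha : dist (y (f i)) (y (f a)) ≤ (1 + η) * nearestDist y (f i)) :
    nearestDist (y ∘ f) a = nearestDist y (f a) := by
  by_cases hai : a = i
  · rw [hai]
    exact nearestDist_comp_embedding_eq_of_local hη y f i hS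
  have hia : f i ≠ f a := f.injective.ne (Ne.symm hai)
  obtain ⟨m, hm, hdm⟩ := exists_nearestDist_eq_dist y ⟨f i, hia⟩
  have hmS : m ∈ Set.range f := by
    refine hS m ?_
    have h1 : nearestDist y (f a) ≤ dist (y (f a)) (y (f i)) := nearestDist_le_dist y hia
    have h2 : dist (y (f i)) (y (f a)) = dist (y (f a)) (y (f i)) := dist_comm _ _
    calc dist (y m) (y (f i)) ≤ dist (y m) (y (f a)) + dist (y (f a)) (y (f i)) :=
          dist_triangle _ _ _
      _ = nearestDist y (f a) + dist (y (f a)) (y (f i)) := by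
          rw [hdm, dist_comm (y m) (y (f a))]
      _ ≤ (1 + η) * nearestDist y (f i) + (1 + η) * nearestDist y (f i) := by linarith
      _ = 2 * (1 + η) * nearestDist y (f i) := by ring
  obtain ⟨b, rfl⟩ := hmS
  exact nearestDist_comp_eq_of_attained y f (f.injective.ne_iff.1 hm) hdm

/-- **Bonds at the centre are local**: `f i ∼ f a` in `y` iff `i ∼ a` in `y ∘ f` (the scales
of both end points are unchanged). [folklore] -/
theorem bondGraph_adj_comp_embedding_iff {η : ℝ} (hη : 0 ≤ η) (y : ι → X) (f : κ ↪ ι) (i : κ)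
    (hS : ∀ k, dist (y k) (y (f i)) ≤ 2 * (1 + η) * nearestDist y (f i) → k ∈ Set.range f)
    (a : κ) : (bondGraph η y).Adj (f i) (f a) ↔ (bondGraph η (y ∘ f)).Adj i a := by
  have hη1 : (0 : ℝ) ≤ 1 + η := by linarith
  have hnn_i := nearestDist_comp_embedding_eq_of_local hη y f i hS
  rw [bondGraph_adj, bondGraph_adj]
  constructor
  · rintro ⟨hne, hle⟩
    have hd : dist (y (f i)) (y (f a)) ≤ (1 + η) * nearestDist y (f i) :=
      hle.trans (mul_le_mul_of_nonneg_left (min_le_left _ _) hη1)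
    refine ⟨f.injective.ne_iff.1 hne, ?_⟩
    show dist (y (f i)) (y (f a)) ≤ (1 + η) * min (nearestDist (y ∘ f) i) (nearestDist (y ∘ f) a)
    rw [hnn_i, nearestDist_comp_embedding_eq_of_near hη y f i hS hd]
    exact hle
  · rintro ⟨hne, hle⟩
    change dist (y (f i)) (y (f a)) ≤
      (1 + η) * min (nearestDist (y ∘ f) i) (nearestDist (y ∘ f) a) at hle
    rw [hnn_i] at hle
    have hd : dist (y (f i)) (y (f a)) ≤ (1 + η) * nearestDist y (f i) :=
      hle.trans (mul_le_mul_of_nonneg_left (min_le_left _ _) hη1)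
    rw [nearestDist_comp_embedding_eq_of_near hη y f i hS hd] at hle
    exact ⟨f.injective.ne hne, hle⟩

omit [Finite ι] in
/-- **Bonds at the centre end in the range**: a bond-neighbour of `f i` is within
`(1+η)·nn ≤ 2(1+η)·nn` of `y (f i)`. [folklore] -/
theorem mem_range_of_bondGraph_adj {η : ℝ} (hη : 0 ≤ η) (y : ι → X) (f : κ ↪ ι) (i : κ)
    (hS : ∀ k, dist (y k) (y (f i)) ≤ 2 * (1 + η) * nearestDist y (f i) → k ∈ Set.range f)
    {k : ι} (hk : (bondGraph η y).Adj (f i) k) : k ∈ Set.range f := by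
  have hη1 : (0 : ℝ) ≤ 1 + η := by linarith
  refine hS k ?_
  rw [dist_comm]
  have h1 : dist (y (f i)) (y k) ≤ (1 + η) * nearestDist y (f i) := dist_le_of_adj hη1 hk
  have h0 : 0 ≤ (1 + η) * nearestDist y (f i) := mul_nonneg hη1 (nearestDist_nonneg _ _)
  linarith

/-- **Bonds between two bond-neighbours of the centre are local**: for bond-neighbours `a, b` of
`i` in `y ∘ f`, `f a ∼ f b` in `y` iff `a ∼ b` in `y ∘ f` (both end points lie within
`(1+η)·nn_{f i}` of `y (f i)`, so both scales are unchanged). [folklore] -/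
theorem bondGraph_adj_comp_embedding_iff_of_adj {η : ℝ} (hη : 0 ≤ η) (y : ι → X) (f : κ ↪ ι)
    (i : κ)
    (hS : ∀ k, dist (y k) (y (f i)) ≤ 2 * (1 + η) * nearestDist y (f i) → k ∈ Set.range f)
    {a b : κ} (ha : (bondGraph η (y ∘ f)).Adj i a) (hb : (bondGraph η (y ∘ f)).Adj i b) :
    (bondGraph η y).Adj (f a) (f b) ↔ (bondGraph η (y ∘ f)).Adj a b := by
  have hη1 : (0 : ℝ) ≤ 1 + η := by linarith
  have ha' : (bondGraph η y).Adj (f i) (f a) := (bondGraph_adj_comp_embedding_iff hη y f i hS a).2 ha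
  have hb' : (bondGraph η y).Adj (f i) (f b) := (bondGraph_adj_comp_embedding_iff hη y f i hS b).2 hb
  have hda : dist (y (f i)) (y (f a)) ≤ (1 + η) * nearestDist y (f i) := dist_le_of_adj hη1 ha'
  have hdb : dist (y (f i)) (y (f b)) ≤ (1 + η) * nearestDist y (f i) := dist_le_of_adj hη1 hb'
  rw [bondGraph_adj, bondGraph_adj]
  change _ ↔ (a ≠ b ∧ dist (y (f a)) (y (f b)) ≤
    (1 + η) * min (nearestDist (y ∘ f) a) (nearestDist (y ∘ f) b))
  rw [nearestDist_comp_embedding_eq_of_near hη y f i hS hda,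
    nearestDist_comp_embedding_eq_of_near hη y f i hS hdb, f.injective.ne_iff]

/-- **Common neighbours along a bond at the centre are local**: for a bond-neighbour `a` of `i`
in `y ∘ f`, `N_y(f i) ∩ N_y(f a) = f '' (N_{y∘f}(i) ∩ N_{y∘f}(a))`. [folklore] -/
theorem neighborSet_inter_comp_embedding_eq {η : ℝ} (hη : 0 ≤ η) (y : ι → X) (f : κ ↪ ι)
    (i : κ)
    (hS : ∀ k, dist (y k) (y (f i)) ≤ 2 * (1 + η) * nearestDist y (f i) → k ∈ Set.range f)
    {a : κ} (ha : (bondGraph η (y ∘ f)).Adj i a) :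
    (bondGraph η y).neighborSet (f i) ∩ (bondGraph η y).neighborSet (f a) =
      f '' ((bondGraph η (y ∘ f)).neighborSet i ∩ (bondGraph η (y ∘ f)).neighborSet a) := by
  ext k
  simp only [Set.mem_inter_iff, SimpleGraph.mem_neighborSet, Set.mem_image]
  constructor
  · rintro ⟨hik, hak⟩
    obtain ⟨b, rfl⟩ := mem_range_of_bondGraph_adj hη y f i hS hik
    have hib : (bondGraph η (y ∘ f)).Adj i b := (bondGraph_adj_comp_embedding_iff hη y f i hS b).1 hik
    exact ⟨b, ⟨hib, (bondGraph_adj_comp_embedding_iff_of_adj hη y f i hS ha hib).1 hak⟩, rfl⟩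
  · rintro ⟨b, ⟨hib, hab⟩, rfl⟩
    exact ⟨(bondGraph_adj_comp_embedding_iff hη y f i hS b).2 hib,
      (bondGraph_adj_comp_embedding_iff_of_adj hη y f i hS ha hib).2 hab⟩

/-- **Ring numbers of the bonds at the centre are local**: for a bond-neighbour `a` of `i` in
`y ∘ f`, `ringNumber η y (f i) (f a) = ringNumber η (y ∘ f) i a` (`f` is injective).
[folklore] -/
theorem ringNumber_comp_embedding_eq {η : ℝ} (hη : 0 ≤ η) (y : ι → X) (f : κ ↪ ι) (i : κ)
    (hS : ∀ k, dist (y k) (y (f i)) ≤ 2 * (1 + η) * nearestDist y (f i) → k ∈ Set.range f)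
    {a : κ} (ha : (bondGraph η (y ∘ f)).Adj i a) :
    ringNumber η y (f i) (f a) = ringNumber η (y ∘ f) i a := by
  rw [ringNumber_def, ringNumber_def, neighborSet_inter_comp_embedding_eq hη y f i hS ha,
    Set.ncard_image_of_injective _ f.injective]

/-- **Ring locality (embedding form).**  Let `0 ≤ η`, let `y : ι → X` be a finite configuration
and `f : κ ↪ ι` a sub-family whose range contains every site within `2(1+η)·nn_{f i}` of
`y (f i)`.  Then `f i` is a RING-DEFECTIVE site of `y` (twelve bonds, some bond with ring number
`≠ 4`: class (R) of the link census) iff `i` is a ring-defective site of `y ∘ f`. [folklore] -/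
theorem ringDefective_comp_embedding_iff {η : ℝ} (hη : 0 ≤ η) (y : ι → X) (f : κ ↪ ι) (i : κ)
    (hS : ∀ k, dist (y k) (y (f i)) ≤ 2 * (1 + η) * nearestDist y (f i) → k ∈ Set.range f) :
    (((bondGraph η y).neighborSet (f i)).ncard = 12 ∧
        ∃ j ∈ (bondGraph η y).neighborSet (f i), ringNumber η y (f i) j ≠ 4) ↔
      (((bondGraph η (y ∘ f)).neighborSet i).ncard = 12 ∧
        ∃ a ∈ (bondGraph η (y ∘ f)).neighborSet i, ringNumber η (y ∘ f) i a ≠ 4) := by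
  -- the neighbour set of `f i` is the `f`-image of that of `i` (the (U)-class locality
  -- `neighborSet_apply_eq_image_comp`, re-derived here from the two bond lemmas)
  have hNi : (bondGraph η y).neighborSet (f i) = f '' (bondGraph η (y ∘ f)).neighborSet i := by
    ext k
    simp only [SimpleGraph.mem_neighborSet, Set.mem_image]
    constructor
    · intro hk
      obtain ⟨a, rfl⟩ := mem_range_of_bondGraph_adj hη y f i hS hk
      exact ⟨a, (bondGraph_adj_comp_embedding_iff hη y f i hS a).1 hk, rfl⟩
    · rintro ⟨a, ha, rfl⟩
      exact (bondGraph_adj_comp_embedding_iff hη y f i hS a).2 ha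
  rw [hNi, Set.ncard_image_of_injective _ f.injective]
  refine and_congr_right fun _ => ?_
  rw [Set.exists_mem_image]
  refine exists_congr fun a => and_congr_right fun ha => ?_
  rw [ringNumber_comp_embedding_eq hη y f i hS ha]

end RingLocality

/-- **Ring locality** (registered `Fin`-indexed form, class (R) of line `birth`): for `0 ≤ η` and a sub-configuration `y ∘ f` (`f : Fin M ↪ Fin N`) of a finite configuration `y : Fin N → ℝ³` whose range contains every site within `2(1+η)·nn_{f i}` of `y (f i)`, the site `f i` is twelve-coordinated with a bond of ring number `≠ 4` in `y` iff `i` is so in `y ∘ f`. [folklore] -/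
theorem ringDefective_sub_iff : ∀ (η : ℝ), 0 ≤ η → ∀ (N M : ℕ) (y : Fin N → EuclideanSpace ℝ (Fin 3)) (f : Fin M ↪ Fin N) (i : Fin M), (∀ k : Fin N, dist (y k) (y (f i)) ≤ 2 * (1 + η) * Literature.Geometry.DiscreteGeometry.nearestDist y (f i) → k ∈ Set.range f) → ((((Literature.Geometry.DiscreteGeometry.bondGraph η y).neighborSet (f i)).ncard = 12 ∧ ∃ j ∈ (Literature.Geometry.DiscreteGeometry.bondGraph η y).neighborSet (f i), Literature.Geometry.DiscreteGeometry.ringNumber η y (f i) j ≠ 4) ↔ (((Literature.Geometry.DiscreteGeometry.bondGraph η (y ∘ f)).neighborSet i).ncard = 12 ∧ ∃ a ∈ (Literature.Geometry.DiscreteGeometry.bondGraph η (y ∘ f)).neighborSet i, Literature.Geometry.DiscreteGeometry.ringNumber η (y ∘ f) i a ≠ 4)) := by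
  intro η hη N M y f i hS
  exact ringDefective_comp_embedding_iff hη y f i hS

end Summit.AtomisticToContinuum.Crystallization.Theorems.PricedLinkCensusTruncatedCensusGap

end
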